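import Mathlib.LinearAlgebra.Matrix.Charpoly.Basic
import Mathlib.LinearAlgebra.Matrix.Symmetric
import Literature.NumberTheory.LFunctions.LocalRiemannHypothesis
import HarnessLib

/-!
# The compressed Berry–Keating Hamiltonian as a Jacobi matrix

Srednicki's spectral proof of the local Riemann hypothesis [cite: Srednicki2011, §2] writes the
polynomial factor of the Mellin transform of the `N = 2K+δ`-th oscillator eigenfunction as the
characteristic polynomial `det_K(E − H_BK)` of the `K × K` tridiagonal ("Jacobi") matrix of
`H_BK = (xp+px)/2` in the oscillator basis of parity `δ` (off-diagonal entries `b_k`, `b_k^*` with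
`|b_k|² = (2k+δ)(2k+δ−1)/4`), and concludes from hermiticity. The companion file
`LocalRiemannHypothesis.lean` proved the real/simple-zeros statement for the three-term recursion
polynomials `jacobiPoly`; here we supply the MATRIX statement that links the two:

* `triDiag a c K` — the `K × K` tridiagonal matrix with zero diagonal, super-diagonal `a_1,…,a_{K−1}`
  and sub-diagonal `c_1,…,c_{K−1}`;
* `charpoly_triDiag` — `charpoly (triDiag a c K) = jacobiPoly (k ↦ a_k c_k) K`, i.e. the determinant
  recursion `det_{K+2} = X·det_{K+1} − a_{K+1}c_{K+1}·det_K` obtained by expanding along the last row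
  [cite: Srednicki2011, §2, "compute the determinant by minors on the last row"];
* `triDiag_isSymm` — `triDiag b b K` is symmetric, and `re_eq_zero_of_charpoly_triDiag_symm` /
  `im_eq_zero_of_isRoot_charpoly_triDiag`: for real `b_k ≠ 0` every complex root of its
  characteristic polynomial is real and simple — the finite Hilbert–Pólya statement
  "a real symmetric Jacobi matrix has real simple spectrum" in the form used by the census of
  finite Hamiltonians (the characteristic polynomial depends on the off-diagonal pair only through
  the products `a_k c_k = |b_k|²`, so Srednicki's Hermitian matrix with `b_k ∈ iℝ` and the real
  symmetric matrix with `|b_k|` have the same characteristic polynomial).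
-/

namespace Literature.NumberTheory.LFunctions

open Polynomial Matrix

namespace LocalRH

variable {R : Type*} [CommRing R]

/-- The `K × K` tridiagonal matrix with zero diagonal, `(i, i+1)` entry `a_{i+1}` and `(i+1, i)` entry
`c_{i+1}` (`0`-indexed rows/columns). [cite: Srednicki2011, §2, matrix ⟨k|H_BK|k'⟩] -/
def triDiag (a c : ℕ → R) (K : ℕ) : Matrix (Fin K) (Fin K) R :=
  Matrix.of fun i j => if (j : ℕ) = i + 1 then a (i + 1) else if (i : ℕ) = j + 1 then c (j + 1) else 0

/-- Entry formula. [cite: Srednicki2011, §2] -/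
theorem triDiag_apply (a c : ℕ → R) (K : ℕ) (i j : Fin K) :
    triDiag a c K i j =
      if (j : ℕ) = i + 1 then a (i + 1) else if (i : ℕ) = j + 1 then c (j + 1) else 0 := rfl

/-- `triDiag b b K` is a symmetric matrix. [cite: Srednicki2011, §2] -/
theorem triDiag_isSymm (b : ℕ → R) (K : ℕ) : (triDiag b b K).IsSymm := by
  ext i j
  simp only [transpose_apply, triDiag_apply]
  split_ifs <;> first | rfl | omega

/-- Deleting the last row and column of the `(K+1) × (K+1)` characteristic matrix leaves the
`K × K` one. [cite: Srednicki2011, §2] -/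
private theorem charmatrix_triDiag_submatrix_castSucc (a c : ℕ → R) (K : ℕ) :
    (charmatrix (triDiag a c (K + 1))).submatrix Fin.castSucc Fin.castSucc =
      charmatrix (triDiag a c K) := by
  ext i j
  simp only [submatrix_apply, charmatrix_apply, diagonal_apply, triDiag_apply, Fin.val_castSucc,
    Fin.castSucc_inj]

/-- **Determinant recursion** for the characteristic polynomials of `triDiag`:
`χ_{K+2} = X·χ_{K+1} − a_{K+1}c_{K+1}·χ_K`. [cite: Srednicki2011, §2, minors on the last row] -/
theorem charpoly_triDiag_add_two (a c : ℕ → R) (K : ℕ) :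
    (triDiag a c (K + 2)).charpoly =
      X * (triDiag a c (K + 1)).charpoly - C (a (K + 1) * c (K + 1)) * (triDiag a c K).charpoly := by
  classical
  set A := charmatrix (triDiag a c (K + 2)) with hA
  have hrow : ∀ j : Fin (K + 2), A (Fin.last (K + 1)) j =
      if (j : ℕ) = K + 1 then X else if (j : ℕ) = K then -C (c (K + 1)) else 0 := by
    intro j
    simp only [hA, charmatrix_apply, diagonal_apply, triDiag_apply, Fin.val_last]
    by_cases h1 : (j : ℕ) = K + 1
    · have : Fin.last (K + 1) = j := Fin.ext (by simp [h1])
      rw [if_pos this, if_pos h1, if_neg (by omega), if_neg (by omega), map_zero, sub_zero]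
    · have : Fin.last (K + 1) ≠ j := fun h => h1 (by rw [← h]; simp)
      rw [if_neg this, if_neg h1, zero_sub, if_neg (by omega)]
      by_cases h2 : (j : ℕ) = K
      · rw [if_pos h2, if_pos (by omega), h2]
      · rw [if_neg h2, if_neg (by omega), map_zero, neg_zero]
  -- expansion along the last row
  rw [Matrix.charpoly, ← hA, det_succ_row A (Fin.last (K + 1)), Fin.sum_univ_castSucc,
    Fin.sum_univ_castSucc]
  -- the terms j = castSucc (castSucc j') vanish
  have hzero : ∑ j : Fin K, (-1) ^ ((Fin.last (K + 1) : ℕ) + (j.castSucc.castSucc : ℕ)) *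
      A (Fin.last (K + 1)) j.castSucc.castSucc *
      (A.submatrix (Fin.last (K + 1)).succAbove j.castSucc.castSucc.succAbove).det = 0 := by
    refine Finset.sum_eq_zero fun j _ => ?_
    rw [hrow]
    have hj := j.isLt
    simp only [Fin.val_castSucc]
    rw [if_neg (by omega), if_neg (by omega)]
    ring
  rw [hzero, zero_add]
  -- the diagonal term: minor = charmatrix of size K+1
  have hdiag : (A.submatrix (Fin.last (K + 1)).succAbove (Fin.last (K + 1)).succAbove).det =
      (triDiag a c (K + 1)).charpoly := by
    rw [Fin.succAbove_last, hA, charmatrix_triDiag_submatrix_castSucc, Matrix.charpoly]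
  -- the sub-diagonal term: minor has last column (0,…,0,−C a_{K+1}); expand along it
  set jK : Fin (K + 2) := (Fin.last K).castSucc with hjK
  have hcol : ∀ i : Fin (K + 1), A i.castSucc (Fin.last (K + 1)) =
      if (i : ℕ) = K then -C (a (K + 1)) else 0 := by
    intro i
    have hne : i.castSucc ≠ Fin.last (K + 1) := fun h => by
      have := congrArg Fin.val h; simp at this; omega
    simp only [hA, charmatrix_apply, diagonal_apply, triDiag_apply, hne, if_false, Fin.val_castSucc,
      Fin.val_last, zero_sub]
    by_cases h : (i : ℕ) = K
    · simp [h]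
    · rw [if_neg (by omega), if_neg (by omega), if_neg h, map_zero, neg_zero]
  have hσ1 : ∀ i : Fin K, jK.succAbove i.castSucc = i.castSucc.castSucc := by
    intro i
    rw [hjK, Fin.succAbove_castSucc_of_lt _ _ (Fin.castSucc_lt_last i)]
  have hσ2 : jK.succAbove (Fin.last K) = Fin.last (K + 1) := by
    rw [hjK, Fin.succAbove_of_le_castSucc _ _ le_rfl, Fin.succ_last]
  have hsub : (A.submatrix (Fin.last (K + 1)).succAbove jK.succAbove).det =
      -C (a (K + 1)) * (triDiag a c K).charpoly := by
    set M := A.submatrix (Fin.last (K + 1)).succAbove jK.succAbove with hM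
    rw [det_succ_column M (Fin.last K), Fin.sum_univ_castSucc]
    have hz : ∑ i : Fin K, (-1) ^ ((i.castSucc : ℕ) + (Fin.last K : ℕ)) * M i.castSucc (Fin.last K) *
        (M.submatrix i.castSucc.succAbove (Fin.last K).succAbove).det = 0 := by
      refine Finset.sum_eq_zero fun i _ => ?_
      have : M i.castSucc (Fin.last K) = 0 := by
        rw [hM, submatrix_apply, Fin.succAbove_last, hσ2, hcol]
        have := i.isLt
        rw [if_neg (by simp only [Fin.val_castSucc]; omega)]
      rw [this]; ring
    rw [hz, zero_add]
    have hlast : M (Fin.last K) (Fin.last K) = -C (a (K + 1)) := by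
      rw [hM, submatrix_apply, Fin.succAbove_last, hσ2, hcol, if_pos (by simp)]
    have hmin : M.submatrix (Fin.last K).succAbove (Fin.last K).succAbove =
        charmatrix (triDiag a c K) := by
      ext i j
      rw [submatrix_apply, Fin.succAbove_last, hM, submatrix_apply, Fin.succAbove_last, hσ1, hA]
      have h1 := charmatrix_triDiag_submatrix_castSucc a c (K + 1)
      have h2 := charmatrix_triDiag_submatrix_castSucc a c K
      rw [← h2, ← h1]
      rfl
    rw [hlast, hmin, ← Matrix.charpoly]
    have : (-1 : R[X]) ^ ((Fin.last K : ℕ) + (Fin.last K : ℕ)) = 1 := by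
      rw [← two_mul, pow_mul, neg_one_sq, one_pow]
    rw [this, one_mul]
  rw [hrow, hrow, hdiag, hsub]
  have hK1 : ¬ ((jK : ℕ) = K + 1) := by simp [hjK]
  have hK2 : (jK : ℕ) = K := by simp [hjK]
  have hK3 : ((Fin.last (K + 1) : Fin (K + 2)) : ℕ) = K + 1 := by simp
  rw [if_neg hK1, if_pos hK2, if_pos hK3, hK2, hK3]
  have e1 : (-1 : R[X]) ^ (K + 1 + K) = -1 := by
    rw [show K + 1 + K = 2 * K + 1 by ring, pow_succ, pow_mul, neg_one_sq, one_pow, one_mul]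
  have e2 : (-1 : R[X]) ^ (K + 1 + (K + 1)) = 1 := by
    rw [← two_mul, pow_mul, neg_one_sq, one_pow]
  rw [e1, e2, C_mul]
  ring

/-- **The characteristic polynomial of the Jacobi matrix is the recursion polynomial**:
`charpoly (triDiag a c K) = jacobiPoly (k ↦ a_k c_k) K` — Srednicki's
`φ_K(E) = det(tridiagonal) · φ_0(E)`. [cite: Srednicki2011, §2, eq. for φ_K] -/
theorem charpoly_triDiag (a c : ℕ → R) : ∀ K, (triDiag a c K).charpoly = jacobiPoly (fun k => a k * c k) K
  | 0 => by
    classical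
    rw [jacobiPoly_zero, Matrix.charpoly, det_isEmpty]
  | 1 => by
    classical
    rw [jacobiPoly_one, Matrix.charpoly, det_fin_one, charmatrix_apply, triDiag_apply]
    simp
  | (K + 2) => by
    rw [charpoly_triDiag_add_two, charpoly_triDiag a c (K + 1), charpoly_triDiag a c K, jacobiPoly_add_two]

/-- **Finite Hilbert–Pólya statement** [cite: Srednicki2011, §2, "the restricted H_BK is hermitian,
and so all its eigenvalues are real"]: for real off-diagonal entries `b_{k} ≠ 0` (`1 ≤ k`), every
complex root of the characteristic polynomial of the symmetric Jacobi matrix `triDiag b b K` is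
real … -/
theorem im_eq_zero_of_aeval_charpoly_triDiag {b : ℕ → ℝ} (hb : ∀ k, b (k + 1) ≠ 0) (K : ℕ) {E : ℂ}
    (hE : aeval E ((triDiag b b K).charpoly) = 0) : E.im = 0 := by
  rw [charpoly_triDiag] at hE
  exact jacobiPoly_im_eq_zero_of_aeval_eq_zero (fun k => mul_self_pos.mpr (hb k)) hE

/-- … and simple. [cite: Srednicki2011, §2] [cite: BumpEtAl2000, Thm 1] -/
theorem aeval_derivative_charpoly_triDiag_ne_zero {b : ℕ → ℝ} (hb : ∀ k, b (k + 1) ≠ 0) (K : ℕ)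
    {E : ℂ} (hE : aeval E ((triDiag b b K).charpoly) = 0) :
    aeval E (derivative (triDiag b b K).charpoly) ≠ 0 := by
  rw [charpoly_triDiag] at hE ⊢
  exact jacobiPoly_derivative_aeval_ne_zero (fun k => mul_self_pos.mpr (hb k)) hE

/-- The Hermite–Mellin polynomial as a characteristic polynomial: with any factorisation
`a_k c_k = (2k+δ)(2k+δ−1)/4` of Srednicki's `|b_k|²` (e.g. `a_k = 1`, `c_k = |b_k|²`, or
`a_k = c_k = |b_k|`), `Q_K(1/2 + iE) = (2i)^K · charpoly(triDiag a c K)(E)`.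
[cite: Srednicki2011, §2, Γ_{∞,N}(½+iE) = c_N det_N(E − H_BK) Γ_{∞,δ}(½+iE)] -/
theorem aeval_hermiteMellinPoly_eq_charpoly (δ : ℕ) {a c : ℕ → ℝ}
    (hac : ∀ k, a k * c k = hermiteWeight δ k) (K : ℕ) (E : ℂ) :
    aeval (1 / 2 + Complex.I * E) (hermiteMellinPoly δ K) =
      (2 * Complex.I) ^ K * aeval E ((triDiag a c K).charpoly) := by
  rw [charpoly_triDiag, aeval_hermiteMellinPoly]
  congr 3
  funext k
  exact (hac k).symm

end LocalRH

end Literature.NumberTheory.LFunctions
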